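import Summits.AnomalousDissipation.AnomalousDissipation.Theses.TwoAndHalfD
import Literature.Analysis.FluidPDE.LongTimeAveragePeriodic
import Literature.Analysis.FluidPDE.LongTimeAverageNonneg

/-!
# Negative knowledge for the crux `ScalarAnomalySteadySourceFormal` (stmt-AnomalousDissipation-0448), I:
# kill shape and the junk calculus of the long-time averages

Certified copy of §1–§2 of the cdisprove work file
`Cruxes/ScalarAnomalySteadySourceFormal/Disproof.lean`: the crux split into named clauses
(`IsAdmissible`, `IsCandidate`, `EnergyBounded`, `VarianceBounded`, `Anomalous`), the exact kill
shape `not_crux_iff` (a refutation is a UNIFORM no-anomaly theorem), and the junk calculus of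
`longTimeAvgSup` (`Real.sInf ∅ = 0`): divergent Cesàro means have long-time average `0`, so the
variance clause is vacuous on divergent families while the anomaly clause forces honest, eventually
bounded dissipation means.  Supports stmt-AnomalousDissipation-0448.
-/

set_option linter.dupNamespace false

noncomputable section

open scoped BigOperators Topology ENNReal NNReal InnerProductSpace
open Filter Set Function MeasureTheory

namespace Summit.AnomalousDissipation.AnomalousDissipation.Theorems.ScalarAnomalySteadySourceFormal.Negative

open Literature.Analysis
open Literature.Analysis.FunctionSpaces Literature.Analysis.FunctionSpaces.Torus
open Literature.Analysis.FluidPDE Literature.Analysis.FluidPDE.Torus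
open Summit.AnomalousDissipation.AnomalousDissipation.Theses.TwoAndHalfD

/-! ## §1 Restatement and the exact kill shape -/

/-- The SOLUTION clauses of a candidate witness family `(ν_j, v₀_j, v_j, θ₀_j, θ_j)` for the data
`(g, h)`: positive viscosities tending to `0`, `v_j` global Leray–Hopf for the steady force `g`,
`L²` scalar data, and `θ_j` a global weak solution of `∂ₜθ + v_j·∇θ = ν_jΔθ + h`
(verbatim the five conjuncts of the route decl). [folklore] -/
structure IsCandidate (g : (UnitAddTorus (Fin 2)) → (EuclideanSpace ℝ (Fin 2))) (h : (UnitAddTorus (Fin 2)) → ℝ) (ν : ℕ → ℝ) (v₀ : ℕ → (UnitAddTorus (Fin 2)) → (EuclideanSpace ℝ (Fin 2)))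
    (v : ℕ → ℝ → (UnitAddTorus (Fin 2)) → (EuclideanSpace ℝ (Fin 2))) (θ₀ : ℕ → (UnitAddTorus (Fin 2)) → ℝ) (θ : ℕ → ℝ → (UnitAddTorus (Fin 2)) → ℝ) : Prop where
  pos : ∀ j, 0 < ν j
  tendsto : Tendsto ν atTop (nhds 0)
  lerayHopf : ∀ j, IsGlobalLerayHopf (ν j) (fun _ => g) (v₀ j) (v j)
  memLp : ∀ j, MemLp (θ₀ j) 2 volume
  weak : ∀ j, IsWeakScalarTransportForced (ν j) (v j) (fun _ => h) (θ₀ j) (θ j)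

/-- The ADMISSIBILITY clauses of the data: `g` smooth, divergence free, mean zero; `h` smooth,
mean zero. [folklore] -/
structure IsAdmissible (g : (UnitAddTorus (Fin 2)) → (EuclideanSpace ℝ (Fin 2))) (h : (UnitAddTorus (Fin 2)) → ℝ) : Prop where
  smooth_g : IsSmooth g
  divFree_g : IsDivFree g
  zeroMean_g : HasZeroMean g
  smooth_h : IsSmooth h
  zeroMean_h : HasZeroMean h

/-- Clause (iv): `ν`-uniform bound on the `limsup`-mean planar energy. [folklore] -/
def EnergyBounded (v : ℕ → ℝ → (UnitAddTorus (Fin 2)) → (EuclideanSpace ℝ (Fin 2))) : Prop :=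
  ∃ E : ℝ, ∀ j, meanEnergy (v j) ≤ E

/-- Clause (v): `ν`-uniform bound on the `limsup`-mean scalar variance `⟨‖θ_j‖²⟩`. [folklore] -/
def VarianceBounded (θ : ℕ → ℝ → (UnitAddTorus (Fin 2)) → ℝ) : Prop :=
  ∃ E : ℝ, ∀ j, longTimeAvgSup (fun t => scalarL2Sq (θ j t)) ≤ E

/-- The scalar dissipation observable `t ↦ ν ‖∇θ(t)‖²` (spectral, `toReal`). [folklore] -/
def dissipation (ν : ℝ) (θ : ℝ → (UnitAddTorus (Fin 2)) → ℝ) : ℝ → ℝ :=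
  fun t => ν * (eScalarGradNormSq (θ t)).toReal

/-- Clause (vi): a `j`-uniform floor `ε > 0` under the `limsup`-mean scalar dissipation. [folklore] -/
def Anomalous (ν : ℕ → ℝ) (θ : ℕ → ℝ → (UnitAddTorus (Fin 2)) → ℝ) : Prop :=
  ∃ ε : ℝ, 0 < ε ∧ ∀ j, ε ≤ longTimeAvgSup (dissipation (ν j) (θ j))

/-- **The crux, restated** through the named clauses (definitional up to bundling). [folklore] -/
theorem crux_iff :
    ScalarAnomalySteadySourceFormal ↔
      ∃ (g : (UnitAddTorus (Fin 2)) → (EuclideanSpace ℝ (Fin 2))) (h : (UnitAddTorus (Fin 2)) → ℝ), IsAdmissible g h ∧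
        ∃ (ν : ℕ → ℝ) (v₀ : ℕ → (UnitAddTorus (Fin 2)) → (EuclideanSpace ℝ (Fin 2))) (v : ℕ → ℝ → (UnitAddTorus (Fin 2)) → (EuclideanSpace ℝ (Fin 2))) (θ₀ : ℕ → (UnitAddTorus (Fin 2)) → ℝ)
          (θ : ℕ → ℝ → (UnitAddTorus (Fin 2)) → ℝ), IsCandidate g h ν v₀ v θ₀ θ ∧ EnergyBounded v ∧
            VarianceBounded θ ∧ Anomalous ν θ := by
  constructor
  · rintro ⟨g, h, hg, hgd, hgm, hh, hhm, ν, v₀, v, θ₀, θ, hν, hν0, hLH, hθ₀, hweak, hE, hV, hε⟩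
    exact ⟨g, h, ⟨hg, hgd, hgm, hh, hhm⟩, ν, v₀, v, θ₀, θ, ⟨hν, hν0, hLH, hθ₀, hweak⟩, hE, hV, hε⟩
  · rintro ⟨g, h, ⟨hg, hgd, hgm, hh, hhm⟩, ν, v₀, v, θ₀, θ, ⟨hν, hν0, hLH, hθ₀, hweak⟩, hE, hV, hε⟩
    exact ⟨g, h, hg, hgd, hgm, hh, hhm, ν, v₀, v, θ₀, θ, hν, hν0, hLH, hθ₀, hweak, hE, hV, hε⟩

/-- **Exact kill shape** (pure logic): `¬ crux` is the UNIFORM statement "for all admissible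
data and every candidate family whose mean planar energy and mean scalar variance are bounded,
the mean scalar dissipation dips below every `ε > 0` at some index `j`" — a no-anomaly theorem
for steadily sourced scalars over steadily forced 2-D Leray–Hopf flows at `Pr = 1`; nothing
less refutes the item. [folklore] -/
theorem not_crux_iff :
    ¬ ScalarAnomalySteadySourceFormal ↔
      ∀ (g : (UnitAddTorus (Fin 2)) → (EuclideanSpace ℝ (Fin 2))) (h : (UnitAddTorus (Fin 2)) → ℝ), IsAdmissible g h →
        ∀ (ν : ℕ → ℝ) (v₀ : ℕ → (UnitAddTorus (Fin 2)) → (EuclideanSpace ℝ (Fin 2))) (v : ℕ → ℝ → (UnitAddTorus (Fin 2)) → (EuclideanSpace ℝ (Fin 2))) (θ₀ : ℕ → (UnitAddTorus (Fin 2)) → ℝ)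
          (θ : ℕ → ℝ → (UnitAddTorus (Fin 2)) → ℝ), IsCandidate g h ν v₀ v θ₀ θ → EnergyBounded v →
            VarianceBounded θ → ∀ ε : ℝ, 0 < ε → ∃ j, longTimeAvgSup (dissipation (ν j) (θ j)) < ε := by
  rw [crux_iff]
  constructor
  · intro H g h hadm ν v₀ v θ₀ θ hc hE hV ε hε
    by_contra hcon
    refine H ⟨g, h, hadm, ν, v₀, v, θ₀, θ, hc, hE, hV, ε, hε, fun j => ?_⟩
    exact not_lt.1 fun hj => hcon ⟨j, hj⟩
  · rintro H ⟨g, h, hadm, ν, v₀, v, θ₀, θ, hc, hE, hV, hA⟩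
    obtain ⟨ε, hε, hfloor⟩ := hA
    obtain ⟨j, hj⟩ := H g h hadm ν v₀ v θ₀ θ hc hE hV ε hε
    exact absurd hj (not_lt.2 (hfloor j))

/-- Subsequences of a witness family are witness families (used silently by every kill
criterion that passes to `ν_{φ(j)}`). [folklore] -/
theorem IsCandidate.comp_strictMono {g : (UnitAddTorus (Fin 2)) → (EuclideanSpace ℝ (Fin 2))} {h : (UnitAddTorus (Fin 2)) → ℝ} {ν : ℕ → ℝ} {v₀ : ℕ → (UnitAddTorus (Fin 2)) → (EuclideanSpace ℝ (Fin 2))}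
    {v : ℕ → ℝ → (UnitAddTorus (Fin 2)) → (EuclideanSpace ℝ (Fin 2))} {θ₀ : ℕ → (UnitAddTorus (Fin 2)) → ℝ} {θ : ℕ → ℝ → (UnitAddTorus (Fin 2)) → ℝ}
    (hc : IsCandidate g h ν v₀ v θ₀ θ) {φ : ℕ → ℕ} (hφ : StrictMono φ) :
    IsCandidate g h (ν ∘ φ) (v₀ ∘ φ) (v ∘ φ) (θ₀ ∘ φ) (θ ∘ φ) :=
  ⟨fun j => hc.pos (φ j), hc.tendsto.comp hφ.tendsto_atTop, fun j => hc.lerayHopf (φ j),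
    fun j => hc.memLp (φ j), fun j => hc.weak (φ j)⟩

/-! ## §2 Junk calculus of the long-time averages -/

/-- The Cesàro mean of a constant over `[0, T]`, `T ≠ 0`, is the constant. [folklore] -/
theorem timeMean_const {c T : ℝ} (hT : T ≠ 0) : timeMean (fun _ => c) T = c := by
  unfold timeMean
  rw [intervalIntegral.integral_const, sub_zero, smul_eq_mul, ← mul_assoc, inv_mul_cancel₀ hT,
    one_mul]

/-- `⟨c⟩⁺ = c`: the long-time average of a constant observable (a steady witness slice has
honest means). [folklore] -/
theorem longTimeAvgSup_const (c : ℝ) : longTimeAvgSup (fun _ => c) = c := by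
  have hper : Function.Periodic (fun _ : ℝ => c) 1 := fun _ => rfl
  rw [longTimeAvgSup_eq_of_periodic hper one_pos, intervalIntegral.integral_const]
  simp

/-- **The junk door.** If the Cesàro means of an observable DIVERGE to `+∞`, its `limsup`
long-time average is the junk value `0` (`Filter.limsup` of an unbounded real family is
`sInf ∅ = 0`).  This is the only way a `≤ E` clause of the crux can hold dishonestly. [folklore] -/
theorem longTimeAvgSup_eq_zero_of_tendsto_atTop {g : ℝ → ℝ}
    (h : Tendsto (timeMean g) atTop atTop) : longTimeAvgSup g = 0 := by
  unfold longTimeAvgSup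
  rw [Filter.limsup_eq]
  have hempty : {a : ℝ | ∀ᶠ T in atTop, timeMean g T ≤ a} = ∅ := by
    ext a
    simp only [Set.mem_setOf_eq, Set.mem_empty_iff_false, iff_false]
    intro ha
    have h2 : ∀ᶠ T in atTop, a + 1 ≤ timeMean g T := h.eventually (eventually_ge_atTop (a + 1))
    obtain ⟨T, hT1, hT2⟩ := (ha.and h2).exists
    linarith
  rw [hempty, Real.sInf_empty]

/-- **The variance clause is vacuous on divergent families**: if every `θ_j` has Cesàro means of
`‖θ_j(t)‖²` diverging to `+∞` (e.g. `‖θ_j(t)‖² → ∞` as `t → ∞`), then `VarianceBounded θ` holds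
with `E = 0`.  (Closed for GENUINE solutions only by dynamics: at fixed `ν_j > 0` the energy
solution of the sourced advection–diffusion equation is bounded in time — mean conservation,
Poincaré and `κ`-damping — and it is the unique weak solution over a Leray–Hopf drift; neither
fact is in the tree for the forced class `IsWeakScalarTransportForcedOn`.) [folklore] -/
theorem varianceBounded_of_tendsto_atTop {θ : ℕ → ℝ → (UnitAddTorus (Fin 2)) → ℝ}
    (h : ∀ j, Tendsto (timeMean fun t => scalarL2Sq (θ j t)) atTop atTop) :
    VarianceBounded θ :=
  ⟨0, fun j => (longTimeAvgSup_eq_zero_of_tendsto_atTop (h j)).le⟩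

/-- **The anomaly clause is junk-proof**: a floor `ε > 0` under `⟨g⟩⁺` forces the Cesàro means
of `g` to be eventually bounded above (the `limsup` is an honest one), … [folklore] -/
theorem isBoundedUnder_timeMean_of_le_longTimeAvgSup {g : ℝ → ℝ} {ε : ℝ} (hε : 0 < ε)
    (h : ε ≤ longTimeAvgSup g) : IsBoundedUnder (· ≤ ·) atTop (timeMean g) := by
  by_contra hnb
  have hempty : {a : ℝ | ∀ᶠ T in atTop, timeMean g T ≤ a} = ∅ := by
    ext a
    simp only [Set.mem_setOf_eq, Set.mem_empty_iff_false, iff_false]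
    exact fun ha => hnb ⟨a, ha⟩
  have h0 : longTimeAvgSup g = 0 := by
    unfold longTimeAvgSup
    rw [Filter.limsup_eq, hempty, Real.sInf_empty]
  linarith

/-- … and co-bounded (the second junk door, `Real.sInf` of a set unbounded below being `0`,
is shut as well), … [folklore] -/
theorem isCoboundedUnder_timeMean_of_le_longTimeAvgSup {g : ℝ → ℝ} {ε : ℝ} (hε : 0 < ε)
    (h : ε ≤ longTimeAvgSup g) : IsCoboundedUnder (· ≤ ·) atTop (timeMean g) := by
  by_contra hnb
  have hnot : ¬ BddBelow {a : ℝ | ∀ᶠ T in atTop, timeMean g T ≤ a} := by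
    rintro ⟨b, hb⟩
    exact hnb ⟨b, fun a ha => hb ha⟩
  have h0 : longTimeAvgSup g = 0 := by
    unfold longTimeAvgSup
    rw [Filter.limsup_eq, Real.sInf_of_not_bddBelow hnot]
  linarith

/-- … so the means exceed `ε - δ` at arbitrarily late horizons `T`, for every `δ > 0`. [folklore] -/
theorem frequently_le_timeMean_of_le_longTimeAvgSup {g : ℝ → ℝ} {ε δ : ℝ} (hε : 0 < ε)
    (hδ : 0 < δ) (h : ε ≤ longTimeAvgSup g) : ∃ᶠ T in atTop, ε - δ ≤ timeMean g T := by
  have hcb := isCoboundedUnder_timeMean_of_le_longTimeAvgSup hε h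
  have hlt : ε - δ < longTimeAvgSup g := by linarith
  unfold longTimeAvgSup at hlt
  exact (frequently_lt_of_lt_limsup hcb hlt).mono fun T hT => hT.le

/-- For a witness family, every dissipation observable has honest (eventually bounded) Cesàro
means. [folklore] -/
theorem isBoundedUnder_timeMean_of_anomalous {ν : ℕ → ℝ} {θ : ℕ → ℝ → (UnitAddTorus (Fin 2)) → ℝ}
    (h : Anomalous ν θ) (j : ℕ) : IsBoundedUnder (· ≤ ·) atTop (timeMean (dissipation (ν j) (θ j))) := by
  obtain ⟨ε, hε, hfloor⟩ := h
  exact isBoundedUnder_timeMean_of_le_longTimeAvgSup hε (hfloor j)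


end Summit.AnomalousDissipation.AnomalousDissipation.Theorems.ScalarAnomalySteadySourceFormal.Negative
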